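import Summits.ABC.IUTFork.Cor312VolumesArchSummands
import HarnessLib

/-!
# [IUTchIII] Cor. 3.12 cone — NON-VACUITY of the archimedean presentation `Cor312Vol.ArchPresentation`
# (abc-iut-w5-d163's hypothesis structure of `Cor312VolumesArchSummands`, p417640) at a ONE-COMPLEX-PLACE MODEL

PROOF-ONLY support file of the abc-iut cell (wave-5 prover seat abc-iut-w5-d235, gen 2; RQ7 second reader of p417640,
kernel probe promoted to a tree witness per the cell's non-vacuity wave protocol: NO `def`, NO `instance`, NO
`structure` — the witnesses are built inside the theorem terms). TAKES NO SIDE on [IUTchIII] Cor. 3.12.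

`Cor312Vol.ArchPresentation L v_ℚ` ([IUTchIII] Prop. 1.2 (vii), Rmk. 1.2.2 (ii) p. 36 "`I_k = {a ∈ k | |a| ≤ π}`";
[AbsTopIII] Prop. 5.8 (v); [IUTchI] Def. 3.1 (a) "`√−1 ∈ F`") asks, over a place `v_ℚ`, for `ℚ`-linear identifications
`log(𝒟^⊢_v) ≃ ℂ` under which the log-shell is the closed ball of radius `π` and the strip- and sign-automorphisms act by
real linear isometries; from it p417640 builds the verbatim local pieces on the REAL archimedean packets and PROVES
`GeneratorsPreserve`. Until abc-iut-w5-d163's companion over abc-iut-c312-5's `Real.logShellsDH` lands, the structure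
has no producer in the tree. THIS FILE records the MODEL witness (honest label: a two-place index — one archimedean
place `∞`, one nonarchimedean bad place — with the INTENDED archimedean carrier `log(𝒟^⊢_∞) := ℂ`, log-shell the
`π`-ball, strip-automorphisms `{1}`, sign automorphisms `{1, −1}`; not initial Θ-data):

* `exists_archPresentation_model` — such `(T, v_ℚ = ∞, L, P)` exist, with `v_ℚ` archimedean (`¬ T.IsNon v_ℚ`);
* `exists_archPieces_generatorsPreserve_model` — hence local pieces `Cor312Vol.LocalPieces L ∞` ON THE REAL ARCHIMEDEAN
  PACKETS `⊗_ℝ ⊕_{v|∞} ℂ` satisfying `GeneratorsPreserve` exist (p417640's headline theorem instantiates), and the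
  [IUTchIV] Step (vii) term `logμ(π^{|S^±_{j+1}|}·B_I) = |S^±_{j+1}|·log π` of p417640 then applies to them
  (`ArchPresentation.logμ_pi_pow_smul_ball`, not restated).

Classical content only (ℂ with its norm; Mathlib's `LinearIsometryEquiv.neg`). [claim: Mochizuki2012, status: disputed]
for the quoted interface; typed ≠ proved; a model witness certifies CONSISTENCY of the hypothesis package, nothing more.
-/

noncomputable section

open Set

namespace Summit.ABC.IUTFork.Cor312Vol.ArchPresentation

open Thm311 Literature.IUT.LogVolume Literature.IUT.LogVolume.Prop15iii
open scoped Pointwise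

/-- **NON-VACUITY (model) of `ArchPresentation`.** There are an index skeleton `T` (two places: `∞` archimedean,
one nonarchimedean bad place; `l⋇ = 2`), its archimedean place `v_ℚ` (`¬ T.IsNon v_ℚ`) and log-shell data `L` with
`log(𝒟^⊢_v) := ℂ`, log-shell `:= closedBall 0 π`, `stripAut := {1}`, `ism := {1, −1}` at every place, carrying an
archimedean presentation at `v_ℚ` (`φ := id`; the isometries are `1` and `LinearIsometryEquiv.neg ℝ`).
[claim: Mochizuki2012, status: disputed] -/
theorem exists_archPresentation_model :
    ∃ (T : ThetaIndex) (vQ : T.VQ) (L : LogShells T), ¬ T.IsNon vQ ∧ Nonempty (ArchPresentation L vQ) := by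
  refine ⟨{ lstar := 2, two_le_lstar := le_rfl, V := Bool, VQ := Bool, over := id, IsNon := fun b => b = true,
            fibre_finite := fun _ => Set.toFinite _, fibre_nonempty := fun b => ⟨b, rfl⟩, Vbad := {true},
            Vbad_nonempty := ⟨true, rfl⟩, Vbad_finite := Set.toFinite _, Vbad_non := fun _ h => h },
          false,
          { carrier := fun _ => ℂ, shell := fun _ => Metric.closedBall (0 : ℂ) Real.pi,
            stripAut := fun _ => {LinearEquiv.refl ℚ ℂ}, ism := fun _ => {LinearEquiv.refl ℚ ℂ, LinearEquiv.neg ℚ},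
            one_mem_stripAut := fun _ => rfl, one_mem_ism := fun _ => Or.inl rfl },
          Bool.false_ne_true, ⟨?_⟩⟩
  exact
    { φ := fun _ => LinearEquiv.refl ℚ ℂ
      shell_eq := fun _ => by
        change (fun x : ℂ => x) '' Metric.closedBall (0 : ℂ) Real.pi = Metric.closedBall (0 : ℂ) Real.pi
        exact Set.image_id' _
      strip_isometry := fun _ g hg => by
        refine ⟨LinearIsometryEquiv.refl ℝ ℂ, fun x => ?_⟩
        have : g = LinearEquiv.refl ℚ ℂ := hg
        subst this
        rfl
      ism_isometry := fun _ g hg => by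
        rcases hg with h | h
        · refine ⟨LinearIsometryEquiv.refl ℝ ℂ, fun x => ?_⟩
          have : g = LinearEquiv.refl ℚ ℂ := h
          subst this
          rfl
        · refine ⟨LinearIsometryEquiv.neg ℝ, fun x => ?_⟩
          have : g = LinearEquiv.neg ℚ := h
          subst this
          rfl }

/-- **The headline theorem of p417640 instantiates**: at the model of `exists_archPresentation_model` there are
verbatim local pieces `V : Cor312Vol.LocalPieces L v_ℚ` on the REAL archimedean packets `⊗_ℝ ⊕_{v|∞} ℂ` (one summand
per label, positive-finite-volume admissibility, normalised packet log-volume) with `V.GeneratorsPreserve` — (Ind1)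
permutations, strip- and sign-automorphism families are intertwined by the comparison with container-preserving maps
— namely `V := P.toLocalPieces` for an archimedean presentation `P` (p417640's
`generatorsPreserve_toLocalPieces`). Model witness (see the module docstring); not initial Θ-data.
[claim: Mochizuki2012, status: disputed] -/
theorem exists_archPieces_generatorsPreserve_model :
    ∃ (T : ThetaIndex) (vQ : T.VQ) (L : LogShells T) (P : ArchPresentation L vQ),
      ¬ T.IsNon vQ ∧ P.toLocalPieces.GeneratorsPreserve := by
  obtain ⟨T, vQ, L, hvQ, ⟨P⟩⟩ := exists_archPresentation_model
  exact ⟨T, vQ, L, P, hvQ, P.generatorsPreserve_toLocalPieces⟩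

end Summit.ABC.IUTFork.Cor312Vol.ArchPresentation

end
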